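import Summits.Schanuel.Schanuel.Theorems.RootDecomp1KRelLiouvilleCell06

/-!
# RootDecomp1KRelLiouvilleCell — lens 1, generation 34 «RELATIVE-LIOUVILLE CELL of 33364» (RootDecomp1KRelLiouvilleCell.lean fc1db392…, 1985 l) — continuation (RootDecomp1KRelLiouvilleCell07): §7 second half — `tower_budget`, `factorial_pos_le_pow`, the certificate `form_lower_bound` (`exp(−(1+Σ|hᵢ|)^11) ≤ |h₀ + h₁ℓ₂ + h₂ℓ_T|`, hypothesis-free)

(lens-1 g34 `RootDecomp1KRelLiouvilleCell.lean`, sha256 fc1db392…9176, own farm rc 0 · 0 sorry · axioms std; critic VERDICT STATUS L1658 PORT GO LOW;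
port by census-1 gen 15 in eight parts `RootDecomp1KRelLiouvilleCell01`–`08` — see the PORT NOTE of part 01; `--supports stmt-Schanuel-33364`; rung 0.)
-/

noncomputable section

open Complex IntermediateField Polynomial
open Summit.Schanuel.Schanuel.Theorems.RootDecomp1KHyper
open Summit.Schanuel.Schanuel.Theorems.RootDecomp1KHyper.HyperCell
open Summit.Schanuel.Schanuel.Theorems.RootDecomp1KGeneric

namespace Summit.Schanuel.Schanuel.Theorems.RootDecomp1KRelLiouvilleCell

section Digits
open LiouvilleNumber
open scoped Nat

/-- Growth bookkeeping of the tower (`k = n₀ - 1 ≥ 3`): `(k+2)(2^{k+1}+2) + 34 ≤ 11·k·k!`. -/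
theorem tower_budget {k : ℕ} (hk : 3 ≤ k) : (k + 2) * (2 ^ (k + 1) + 2) + 34 ≤ 11 * (k * k !) := by
  induction k, hk using Nat.le_induction with
  | base => decide
  | succ k hk ih =>
    have h1 : (k + 1)! = (k + 1) * k ! := Nat.factorial_succ k
    have h2 : 2 ^ (k + 1 + 1) = 2 * 2 ^ (k + 1) := by rw [pow_succ]; ring
    have h3 : 1 ≤ k ! := Nat.factorial_pos k
    have ih2 := Nat.mul_le_mul_left (k + 2) ih
    have h4 : 3 * 2 ^ (k + 1) ≤ k * 2 ^ (k + 1) := Nat.mul_le_mul_right _ hk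
    rw [h1, h2]
    nlinarith [ih2, h3, h4, Nat.zero_le (k * 2 ^ (k + 1)), Nat.zero_le (k ! * k)]

/-- The scale bookkeeping: if `n₀ ≥ 2` is the least scale with `8 S ≤ 2^{n₀·n₀!}` (minimality `hmin`),
every position `P ≤ 2^{n₀} + 2` has `P! + 1 ≤ (1 + S)^{11}`. -/
theorem factorial_pos_le_pow {S : ℤ} {n₀ P : ℕ} (hn : 2 ≤ n₀) (h1S : 1 ≤ S)
    (hmin : ¬ (8 * S ≤ 2 ^ ((n₀ - 1) * (n₀ - 1)!))) (hP : P ≤ 2 ^ n₀ + 2) :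
    ((P ! : ℕ) : ℝ) + 1 ≤ (1 + (S : ℝ)) ^ 11 := by
  have hS1 : (1 : ℝ) ≤ S := by exact_mod_cast h1S
  rcases Nat.lt_or_ge n₀ 4 with hlt | hge
  · -- `n₀ ∈ {2, 3}`: `P ≤ 10`, and `S ≥ 3` when `n₀ = 3`
    interval_cases n₀
    · have hP6 : P ! ≤ 720 := (Nat.factorial_le (by simpa using hP)).trans (by decide)
      have hP6R : ((P ! : ℕ) : ℝ) ≤ 720 := by exact_mod_cast hP6
      have h2 : (2 : ℝ) ^ 11 ≤ (1 + (S : ℝ)) ^ 11 := pow_le_pow_left₀ (by norm_num) (by linarith) 11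
      nlinarith [h2]
    · have hS3 : (3 : ℤ) ≤ S := by
        norm_num [Nat.factorial] at hmin
        omega
      have hS3R : (3 : ℝ) ≤ S := by exact_mod_cast hS3
      have hP10 : P ! ≤ 3628800 := (Nat.factorial_le (by simpa using hP)).trans (by decide)
      have hP10R : ((P ! : ℕ) : ℝ) ≤ 3628800 := by exact_mod_cast hP10
      have h4 : (4 : ℝ) ^ 11 ≤ (1 + (S : ℝ)) ^ 11 := pow_le_pow_left₀ (by norm_num) (by linarith) 11
      nlinarith [h4]
  · -- `n₀ ≥ 4`: write `n₀ = k + 1`, `k ≥ 3`, `E = k·k!`; minimality gives `2^E < 8S`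
    obtain ⟨k, rfl⟩ : ∃ k, n₀ = k + 1 := ⟨n₀ - 1, by omega⟩
    have hk : 3 ≤ k := by omega
    simp only [Nat.add_sub_cancel] at hmin
    set E : ℕ := k * k ! with hE
    have hbud := tower_budget hk
    have hE3 : 34 ≤ 11 * E := le_trans (by omega) hbud
    -- ℕ-side: `P! + 1 ≤ 2^(11 E - 33)`
    have hP' : P ≤ 2 ^ (k + 2) := by
      have : 2 ^ (k + 2) = 2 * 2 ^ (k + 1) := by rw [pow_succ]; ring
      have : 2 ≤ 2 ^ (k + 1) := by
        calc 2 = 2 ^ 1 := by norm_num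
          _ ≤ 2 ^ (k + 1) := Nat.pow_le_pow_right (by norm_num) (by omega)
      omega
    have hnat : P ! + 1 ≤ 2 ^ (11 * E - 33) := by
      have a1 : P ! ≤ P ^ P := Nat.factorial_le_pow P
      have a2 : P ^ P ≤ (2 ^ (k + 2)) ^ P := Nat.pow_le_pow_left hP' P
      have a3 : (2 ^ (k + 2)) ^ P = 2 ^ ((k + 2) * P) := by rw [← pow_mul]
      have a4 : (k + 2) * P ≤ (k + 2) * (2 ^ (k + 1) + 2) := Nat.mul_le_mul_left _ hP
      have a5 : 2 ^ ((k + 2) * P) + 1 ≤ 2 ^ ((k + 2) * P + 1) := by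
        have : 1 ≤ 2 ^ ((k + 2) * P) := Nat.one_le_two_pow
        rw [pow_succ]; omega
      have a6 : (k + 2) * P + 1 ≤ 11 * E - 33 := by omega
      calc P ! + 1 ≤ 2 ^ ((k + 2) * P) + 1 := by rw [← a3]; omega
        _ ≤ 2 ^ ((k + 2) * P + 1) := a5
        _ ≤ 2 ^ (11 * E - 33) := Nat.pow_le_pow_right (by norm_num) a6
    -- ℝ-side
    have hminR : (2 : ℝ) ^ E < 8 * S := by
      have : (2 : ℤ) ^ E < 8 * S := lt_of_not_ge hmin
      exact_mod_cast this
    have hE3' : 3 ≤ E := by omega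
    have h2E : (2 : ℝ) ^ E = 2 ^ (E - 3) * 8 := by
      rw [show (8 : ℝ) = 2 ^ 3 by norm_num, ← pow_add, Nat.sub_add_cancel hE3']
    have hbase : (2 : ℝ) ^ (E - 3) ≤ 1 + S := by nlinarith [hminR, h2E]
    have e11 : 11 * E - 33 = 11 * (E - 3) := by omega
    calc ((P ! : ℕ) : ℝ) + 1 = ((P ! + 1 : ℕ) : ℝ) := by push_cast; ring
      _ ≤ ((2 ^ (11 * E - 33) : ℕ) : ℝ) := by exact_mod_cast hnat
      _ = ((2 : ℝ) ^ (E - 3)) ^ 11 := by push_cast; rw [e11, pow_mul']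
      _ ≤ (1 + (S : ℝ)) ^ 11 := pow_le_pow_left₀ (by positivity) hbase 11

/-- **THE CERTIFICATE (quantitative).** Every non-zero integer linear form in `(1, ℓ₂, ℓ_T)` is bounded
below by `exp(-(1 + |h₀| + |h₁| + |h₂|)^{11})`: the pair `(ℓ₂, ℓ_T)` — Liouville to every polynomial
order through `ℓ₂` — admits NO hyper-small forms. -/
theorem form_lower_bound (h : Fin 3 → ℤ) (hh : h ≠ 0) :
    Real.exp (-((1 + ∑ i, (|h i| : ℝ)) ^ 11)) ≤
      |(h 0 : ℝ) + h 1 * liouvilleNumber 2 + h 2 * ellT| := by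
  classical
  have hsum3 : ∑ i, (|h i| : ℝ) = |(h 0 : ℝ)| + |(h 1 : ℝ)| + |(h 2 : ℝ)| := by
    simp only [Fin.sum_univ_three]
  set S : ℤ := |h 1| + |h 2| with hSdef
  have ha1 := abs_nonneg (h 1)
  have ha2 := abs_nonneg (h 2)
  have hX1 : (1 : ℝ) + S ≤ 1 + ∑ i, (|h i| : ℝ) := by
    rw [hsum3, hSdef]; push_cast; linarith [abs_nonneg ((h 0 : ℤ) : ℝ)]
  have hXpos : (0 : ℝ) < 1 + ∑ i, (|h i| : ℝ) := by
    have : (0 : ℝ) ≤ S := by exact_mod_cast (show (0 : ℤ) ≤ S by omega)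
    linarith
  by_cases hS : S = 0
  · -- `h₁ = h₂ = 0`, so `h₀ ≠ 0` and the form is the integer `h₀`
    have e1 : h 1 = 0 := abs_eq_zero.mp (by omega)
    have e2 : h 2 = 0 := abs_eq_zero.mp (by omega)
    have e0 : h 0 ≠ 0 := by
      intro e0; apply hh; funext i; fin_cases i <;> simp [e0, e1, e2]
    rw [e1, e2]; push_cast; simp only [zero_mul, add_zero]
    calc Real.exp (-((1 + ∑ i, (|h i| : ℝ)) ^ 11)) ≤ Real.exp 0 :=
          Real.exp_le_exp.mpr (by have := pow_pos hXpos 11; linarith)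
      _ = 1 := Real.exp_zero
      _ ≤ |(h 0 : ℝ)| := by exact_mod_cast Int.one_le_abs e0
  · have h1S : 1 ≤ S := by omega
    -- the first scale `n₀` with `2^{n₀ n₀!} ≥ 8 S`
    have hex : ∃ n, 1 ≤ n ∧ 8 * S ≤ 2 ^ (n * n !) := by
      set N : ℕ := (8 * S).toNat with hNdef
      have eN : (N : ℤ) = 8 * S := Int.toNat_of_nonneg (by omega)
      have hN2 : (N : ℤ) < 2 ^ N := by exact_mod_cast (Nat.lt_two_pow_self : N < 2 ^ N)
      have hNN : (2 : ℤ) ^ N ≤ 2 ^ (N * N !) :=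
        pow_le_pow_right₀ (by norm_num) (Nat.le_mul_of_pos_right N (Nat.factorial_pos N))
      refine ⟨N, ?_, ?_⟩
      · have : (1 : ℤ) ≤ N := by rw [eN]; omega
        exact_mod_cast this
      · rw [eN] at hN2; exact (hN2.trans_le hNN).le
    set n₀ := Nat.find hex with hn₀def
    obtain ⟨hn₀1, hn₀gap⟩ : 1 ≤ n₀ ∧ 8 * S ≤ 2 ^ (n₀ * n₀ !) := Nat.find_spec hex
    have hn₀2 : 2 ≤ n₀ := by
      by_contra hlt
      have e : n₀ = 1 := by omega
      rw [e] at hn₀gap; norm_num [Nat.factorial] at hn₀gap; omega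
    have hmin : ¬ (8 * S ≤ 2 ^ ((n₀ - 1) * (n₀ - 1)!)) := fun hc =>
      Nat.find_min hex (show n₀ - 1 < Nat.find hex by rw [← hn₀def]; omega) ⟨by omega, hc⟩
    -- a non-zero digit at a controlled position
    have h12 : h 1 ≠ 0 ∨ h 2 ≠ 0 := by
      by_cases e1 : h 1 = 0
      · right; intro e2; apply hS; rw [hSdef, e1, e2]; simp
      · exact Or.inl e1
    obtain ⟨P, hP1, hP2, huP⟩ := exists_digit_ne_zero (h 1) (h 2) h12 hn₀1
    obtain ⟨n, rfl⟩ : ∃ n, P = n + 1 := ⟨P - 1, by omega⟩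
    have hn1 : 1 ≤ n := by omega
    have hgap : 8 * S ≤ 2 ^ (n * n !) :=
      hn₀gap.trans (pow_le_pow_right₀ (by norm_num)
        (Nat.mul_le_mul (by omega) (Nat.factorial_le (by omega))))
    have hSk : ∀ k, |h 1 + h 2 * tInd k| ≤ S := fun k => by
      calc |h 1 + h 2 * tInd k| ≤ |h 1| + |h 2 * tInd k| := abs_add_le _ _
        _ = |h 1| + |h 2| * |tInd k| := by rw [abs_mul]
        _ ≤ |h 1| + |h 2| * 1 := by gcongr; exact abs_tInd_le k
        _ = S := by rw [hSdef, mul_one]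
    have hlow := digit_lower_bound hSk hn1 hgap huP (h 0)
    rw [← form_eq_digitSum] at hlow
    -- `exp(-(1+Σ|h|)^11) ≤ exp(-((n+1)!+1)) ≤ 2^{-(n+1)!-1} ≤ |form|`
    have hbud := factorial_pos_le_pow hn₀2 h1S hmin hP2
    have hpow : (((n + 1)! : ℕ) : ℝ) + 1 ≤ (1 + ∑ i, (|h i| : ℝ)) ^ 11 :=
      hbud.trans (pow_le_pow_left₀ (by positivity) hX1 11)
    calc Real.exp (-((1 + ∑ i, (|h i| : ℝ)) ^ 11)) ≤ Real.exp (-((((n + 1)! : ℕ) : ℝ) + 1)) :=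
          Real.exp_le_exp.mpr (neg_le_neg hpow)
      _ ≤ 1 / (2 : ℝ) ^ ((n + 1)! + 1) := by
          rw [Real.exp_neg, ← one_div]
          refine one_div_le_one_div_of_le (by positivity) ?_
          have h2e : (2 : ℝ) ^ ((n + 1)! + 1) ≤ Real.exp 1 ^ ((n + 1)! + 1) :=
            pow_le_pow_left₀ (by norm_num) (by have := Real.exp_one_gt_d9; linarith) _
          rw [Real.exp_one_pow] at h2e
          push_cast at h2e
          exact h2e
      _ ≤ _ := hlow

end Digits

end Summit.Schanuel.Schanuel.Theorems.RootDecomp1KRelLiouvilleCell
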